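import Summits.HodgeConjecture.HodgeConjecture.Theses.HeckePrymWeil
import Literature.AlgebraicGeometry.Motives.AbelianVarietyProduct
import Literature.AlgebraicGeometry.Motives.AbelianVarietyProductDimProofs
import Literature.AlgebraicGeometry.Motives.HyperbolicWeilType
import Literature.AlgebraicGeometry.Motives.HyperbolicWeilTypeProduct
import Literature.AlgebraicGeometry.Motives.HyperbolicWeilTypeProductModel
import Literature.AlgebraicGeometry.HodgeTheory.AbelianVarietyMultiplicationPullback
import Literature.AlgebraicGeometry.HodgeTheory.AbelianVarietyEndomorphismsHOne
import Summits.HodgeConjecture.HodgeConjecture.Theorems.HeckePrymWeilWeilSixfoldsSqrtMinus7HyperplaneCalculusSym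
import HarnessLib

/-!
# Crux `WeilSixfoldsSqrtMinus7` (stmt-HodgeConjecture-1260), line `real-quadratic-base-change` — stub `stub_baseChangeModel`

**The rational degree-one model of the base change `A ⊗ O_F = A × A`** (B. van Geemen, LNM 1594 (1994),
Lemma 5.2 (1)–(3), for the CM field `L = ℚ(√-7, √t)` acting on `A × A`). Let `(A, φ)` be a complex
abelian sixfold with `φ ≫ φ = -7`, `e_A` a projective embedding with a rational class `a ≠ 0` of
`H²(ℙᴺ(ℂ); ℂ)`, `h_A = 7·e_A^*a + φ^*e_A^*a` the `K`-symmetrised hyperplane class, and `(u, M, G, ω, d₀)`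
a rational degree-one model of `(A, φ, h_A)` (`φ^* uᵢ = Σ_k M_{ki} u_k`, `Q_{h_A,5}(uᵢ, u_k) = G_{ik}·ω`,
`h_A⁶ = L⁵_{h_A} h_A = d₀·ω`). On `A × A` put `ψ_K = φ × φ = (fst ≫ φ, snd ≫ φ)` and, for `t ≥ 1`,
`ψ_F = (t·snd, fst) : (x, y) ↦ (t y, x)`. Then (`stub_baseChangeModel`) there are a projective
embedding `e` of `A × A`, a rational `a' ≠ 0`, `r ∈ ℚ` and a top class `Ω` such that, on the Künneth
frame `w = (fst^* uᵢ)ᵢ ⊔ (snd^* uᵢ)ᵢ` of `H¹((A × A)(ℂ); ℂ)`: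

* `ψ_K^*` has matrix `M ⊕ M` (the tree's `Motives.map_prodLift_sumElim`);
* `ψ_F^*` has matrix `(0 1; t·1 0)`: `ψ_F^* fst^* uᵢ = t·snd^* uᵢ`, `ψ_F^* snd^* uᵢ = fst^* uᵢ`
  (`ψ_F ≫ fst = t·snd = snd ≫ [t]`, `ψ_F ≫ snd = fst`, and `[t]^* = tᵏ` on `Hᵏ`,
  `HodgeTheory.complexBetti_map_nsmul_id_apply`);
* the polarization pairing `Q_{h,11}` of the `L`-symmetrised hyperplane class
  `h = 7·(t·e^*a' + ψ_F^* e^*a') + ψ_K^*(t·e^*a' + ψ_F^* e^*a')` has Gram matrix `r·(tG ⊕ G)` with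
  respect to `Ω = fst^*ω ⌣ snd^*ω`, `r = 462·d₀·t⁵·(1+t)¹¹`.

Proof. `e` is the Segre embedding `σ ∘ (e_A × e_A)` and `a' = q·g` where `a = q·g` for the compatible
rational hyperplane classes `g_N` of `HyperbolicEightfoldDescent.stub_hyperplaneCalculusSym` (clauses
(4) Segre additivity and (6) spanning), so that `e^*a' = fst^* e_A^*a + snd^* e_A^*a`. Since
`ψ_F^* fst^* = t²·snd^*` on `H²` and `ψ_F^* snd^* = fst^*`, `(t + ψ_F^*)(e^*a') = (1+t)·(fst^* x + t·snd^* x)`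
(`x = e_A^* a`), and since `ψ_K^* fst^* = fst^* φ^*`, `ψ_K^* snd^* = snd^* φ^*`,
`h = fst^*((1+t)·h_A) + snd^*((1+t)t·h_A)` (`map_lSymm_segreClass`). The models of the rescaled classes
are `((1+t)⁵ G, (1+t)⁶ d₀)` and `(((1+t)t)⁵ G, ((1+t)t)⁶ d₀)` (`polarizationPairingOne_smul`,
`lefschetzPow_smul`), and the tree's block Gram matrix `Motives.polarizationPairingOne_sumElim`
(`jA = jB = 5`, `m = 11`, `C(11,5) = C(11,6) = 462`) is `462·d₀·t⁵·(1+t)¹¹ · (tG ⊕ G)` entrywise.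
Everything is proved; no definition and no named fact is introduced.

## References

* [vanGeemen1994HodgeAV] B. van Geemen, An introduction to the Hodge conjecture for abelian
  varieties, LNM 1594 (1994), Lemma 5.2 (1)–(3).
* [LangeBirkenhake1992] Ch. Birkenhake, H. Lange, Complex Abelian Varieties (1992), Lemma 1.7.4, §5.3.
-/

noncomputable section

-- single-problem summit (Problem = Summit): the mandated namespace repeats `HodgeConjecture`.
set_option linter.dupNamespace false

open CategoryTheory
open Literature.AlgebraicGeometry.Motives Literature.AlgebraicGeometry.HodgeTheory
open Literature.AlgebraicGeometry.Motives.AbelianVariety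
open Literature.AlgebraicTopology.SingularHomology Literature.Geometry.Kaehler

namespace Summit.HodgeConjecture.HodgeConjecture.Theorems.WeilSixfoldsSqrtMinus7.RealQuadraticBaseChange

/-! ### `ψ_F = (t·snd, fst)` on cohomology -/

/-- `ψ_F ≫ fst = t·snd = snd ≫ [t]` for `ψ_F = (t·snd, fst) : A × A → A × A` (first component of the
base-changed real multiplication `√t ⊗ 1`, in the coordinates `1, √t` of `O_F`).
[cite: vanGeemen1994HodgeAV, Lemma 5.2 (1)–(3)] -/
theorem psiF_comp_fst (A : AbelianVariety ℂ) (t : ℕ) :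
    prodLift ((t : ℤ) • snd A A) (fst A A) ≫ fst A A = snd A A ≫ (t • 𝟙 A) := by
  rw [prodLift_fst, natCast_zsmul, Preadditive.comp_nsmul, Category.comp_id]

/-- `ψ_F^* fst^* x = tᵏ · snd^* x` on `Hᵏ(A(ℂ); ℂ)` (`ψ_F ≫ fst = snd ≫ [t]` and `[t]^* = tᵏ` on `Hᵏ`).
[cite: vanGeemen1994HodgeAV, Lemma 5.2 (1)–(3)] -/
theorem map_psiF_map_fst (A : AbelianVariety ℂ) (t k : ℕ) (x : complexBetti A.X k) :
    complexBetti.map (prodLift ((t : ℤ) • snd A A) (fst A A)).hom.hom.hom k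
        (complexBetti.map (fst A A).hom.hom.hom k x) =
      ((t : ℂ) ^ k) • complexBetti.map (snd A A).hom.hom.hom k x := by
  rw [complexBetti_map_map_hom, psiF_comp_fst, ← complexBetti_map_map_hom,
    complexBetti_map_nsmul_id_apply, map_smul]

/-- `ψ_F^* snd^* x = fst^* x` on `Hᵏ(A(ℂ); ℂ)` (`ψ_F ≫ snd = fst`).
[cite: vanGeemen1994HodgeAV, Lemma 5.2 (1)–(3)] -/
theorem map_psiF_map_snd (A : AbelianVariety ℂ) (t k : ℕ) (x : complexBetti A.X k) :
    complexBetti.map (prodLift ((t : ℤ) • snd A A) (fst A A)).hom.hom.hom k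
        (complexBetti.map (snd A A).hom.hom.hom k x) =
      complexBetti.map (fst A A).hom.hom.hom k x := by
  rw [complexBetti_map_map_hom, prodLift_snd]

/-- **The `L`-symmetrised Segre class is a weighted product class**: for `x ∈ H²(A(ℂ); ℂ)` and
`y = fst^* x + snd^* x` (the hyperplane class of the Segre embedding `σ ∘ (e_A × e_A)` when
`x = e_A^* a`), `7·(t·y + ψ_F^* y) + ψ_K^*(t·y + ψ_F^* y) = fst^*((1+t)·h) + snd^*(((1+t)t)·h)` with
`h = 7·x + φ^* x` (`ψ_F^* fst^* = t²·snd^*`, `ψ_F^* snd^* = fst^*` on `H²`; `ψ_K^* fst^* = fst^* φ^*`,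
`ψ_K^* snd^* = snd^* φ^*`). [cite: vanGeemen1994HodgeAV, Lemma 5.2 (1)–(3)] -/
theorem map_lSymm_segreClass (A : AbelianVariety ℂ) (φ : A ⟶ A) (t : ℕ) (x : complexBetti A.X 2) :
    (7 : ℂ) • (((t : ℂ) • (complexBetti.map (fst A A).hom.hom.hom 2 x + complexBetti.map (snd A A).hom.hom.hom 2 x) +
        complexBetti.map (prodLift ((t : ℤ) • snd A A) (fst A A)).hom.hom.hom 2
          (complexBetti.map (fst A A).hom.hom.hom 2 x + complexBetti.map (snd A A).hom.hom.hom 2 x))) +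
      complexBetti.map (prodLift (fst A A ≫ φ) (snd A A ≫ φ)).hom.hom.hom 2
        ((t : ℂ) • (complexBetti.map (fst A A).hom.hom.hom 2 x + complexBetti.map (snd A A).hom.hom.hom 2 x) +
          complexBetti.map (prodLift ((t : ℤ) • snd A A) (fst A A)).hom.hom.hom 2
            (complexBetti.map (fst A A).hom.hom.hom 2 x + complexBetti.map (snd A A).hom.hom.hom 2 x)) =
      complexBetti.map (fst A A).hom.hom.hom 2 (((t : ℂ) + 1) • ((7 : ℂ) • x + complexBetti.map φ.hom.hom.hom 2 x)) +
        complexBetti.map (snd A A).hom.hom.hom 2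
          ((((t : ℂ) + 1) * (t : ℂ)) • ((7 : ℂ) • x + complexBetti.map φ.hom.hom.hom 2 x)) := by
  have hF := map_psiF_map_fst A t 2 x
  have hS := map_psiF_map_snd A t 2 x
  have hKF := map_prodLift_map_fst φ φ 2 x
  have hKS := map_prodLift_map_snd φ φ 2 x
  simp only [map_add, map_smul, hF, hS]
  rw [hKF, hKS]
  module

/-! ### Two sums over the Künneth frame -/

/-- `Σ_j (1)_{ji} · v_j = v_i` for the identity matrix (rational entries cast to `ℂ`). [folklore] -/
theorem sum_ratCast_one_apply_smul {n : Type} [Fintype n] [DecidableEq n] {V : Type*} [AddCommGroup V]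
    [Module ℂ V] (v : n → V) (i : n) :
    ∑ j, (((1 : Matrix n n ℚ) j i : ℚ) : ℂ) • v j = v i := by
  rw [Finset.sum_eq_single i]
  · rw [Matrix.one_apply_eq, Rat.cast_one, one_smul]
  · intro j _ hj
    rw [Matrix.one_apply_ne hj, Rat.cast_zero, zero_smul]
  · intro h
    exact absurd (Finset.mem_univ i) h

/-- `Σ_j (c·1)_{ji} · v_j = c · v_i` for a scalar matrix (rational entries cast to `ℂ`). [folklore] -/
theorem sum_ratCast_smul_one_apply_smul {n : Type} [Fintype n] [DecidableEq n] {V : Type*} [AddCommGroup V]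
    [Module ℂ V] (c : ℚ) (v : n → V) (i : n) :
    ∑ j, (((c • (1 : Matrix n n ℚ)) j i : ℚ) : ℂ) • v j = ((c : ℚ) : ℂ) • v i := by
  simp only [Matrix.smul_apply, smul_eq_mul, Rat.cast_mul, mul_smul, ← Finset.smul_sum]
  rw [sum_ratCast_one_apply_smul]

/-! ### The model of the base change -/

/-- **Stub `stub_baseChangeModel` of line `real-quadratic-base-change` (the rational degree-one model
of the base change `A ⊗ O_F = A × A`; van Geemen, LNM 1594, Lemma 5.2 (1)–(3)).** For a sixfold
`(A, φ)`, `φ ≫ φ = -7`, a projective embedding `e_A` with a rational `a ≠ 0`, a rational degree-one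
model `(u, M, G, ω, d₀)` of `(A, φ, h_A)`, `h_A = 7·e_A^*a + φ^*e_A^*a`, and `t ≥ 1`: there are a
projective embedding `e` of `A × A` (the Segre embedding `σ ∘ (e_A × e_A)`), a rational `a' ≠ 0` with
`e^*a' = fst^* e_A^*a + snd^* e_A^*a` (clauses (4), (6) of `stub_hyperplaneCalculusSym`), `r ∈ ℚ`
(`= 462·d₀·t⁵·(1+t)¹¹`) and `Ω` (`= fst^*ω ⌣ snd^*ω`) such that on the Künneth frame
`(fst^* uᵢ) ⊔ (snd^* uᵢ)`: `ψ_K^* = (φ × φ)^*` has matrix `M ⊕ M`, `ψ_F^* = (t·snd, fst)^*` has matrix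
`(0 1; t·1 0)`, and `Q_{h,11}` of the `L`-symmetrised class
`h = 7·(t·e^*a' + ψ_F^*e^*a') + ψ_K^*(t·e^*a' + ψ_F^*e^*a') = fst^*((1+t)h_A) + snd^*((1+t)t·h_A)` has
Gram matrix `r·(tG ⊕ G)` w.r.t. `Ω` (the tree's `polarizationPairingOne_sumElim` at `jA = jB = 5`,
`m = 11`). [cite: vanGeemen1994HodgeAV, Lemma 5.2 (1)–(3)] -/
theorem stub_baseChangeModel :
    ∀ (A : AbelianVariety ℂ) (φ : A ⟶ A), A.dim = 6 → φ ≫ φ = -((7 : ℤ) • 𝟙 A) →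
      ∀ (eA : ProjectiveEmbedding A.X) (a : complexBetti (projectiveSpace eA.n ℂ) 2),
        IsRationalClass a → a ≠ 0 →
      ∀ (u : Fin 12 → complexBetti A.X 1) (M G : Matrix (Fin 12) (Fin 12) ℚ)
        (ω : complexBetti A.X (2 + 2 * 5)) (d₀ : ℚ),
        (∀ i, IsRationalClass (u i)) → LinearIndependent ℂ u → Submodule.span ℂ (Set.range u) = ⊤ →
        (∀ i, complexBetti.map φ.hom.hom.hom 1 (u i) = ∑ k, ((M k i : ℚ) : ℂ) • u k) →
        (∀ i k, polarizationPairingOne A.X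
            ((7 : ℂ) • complexBetti.map eA.ι 2 a + complexBetti.map φ.hom.hom.hom 2 (complexBetti.map eA.ι 2 a))
            5 (u i) (u k) = ((G i k : ℚ) : ℂ) • ω) →
        lefschetzPow
            ((7 : ℂ) • complexBetti.map eA.ι 2 a + complexBetti.map φ.hom.hom.hom 2 (complexBetti.map eA.ι 2 a))
            5 2
            ((7 : ℂ) • complexBetti.map eA.ι 2 a + complexBetti.map φ.hom.hom.hom 2 (complexBetti.map eA.ι 2 a)) =
          ((d₀ : ℚ) : ℂ) • ω →
      ∀ t : ℕ, 0 < t →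
        ∃ (e : ProjectiveEmbedding (A.prod A).X) (a' : complexBetti (projectiveSpace e.n ℂ) 2) (r : ℚ)
          (Ω : complexBetti (A.prod A).X (2 + 2 * 11)),
          IsRationalClass a' ∧ a' ≠ 0 ∧
          (∀ k : Fin 12 ⊕ Fin 12, complexBetti.map (prodLift (fst A A ≫ φ) (snd A A ≫ φ)).hom.hom.hom 1
              (Sum.elim (fun i => complexBetti.map (fst A A).hom.hom.hom 1 (u i))
                (fun i => complexBetti.map (snd A A).hom.hom.hom 1 (u i)) k) =
            ∑ l, ((Matrix.fromBlocks M 0 0 M l k : ℚ) : ℂ) •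
              Sum.elim (fun i => complexBetti.map (fst A A).hom.hom.hom 1 (u i))
                (fun i => complexBetti.map (snd A A).hom.hom.hom 1 (u i)) l) ∧
          (∀ k : Fin 12 ⊕ Fin 12, complexBetti.map (prodLift ((t : ℤ) • snd A A) (fst A A)).hom.hom.hom 1
              (Sum.elim (fun i => complexBetti.map (fst A A).hom.hom.hom 1 (u i))
                (fun i => complexBetti.map (snd A A).hom.hom.hom 1 (u i)) k) =
            ∑ l, ((Matrix.fromBlocks (0 : Matrix (Fin 12) (Fin 12) ℚ) 1
                    ((t : ℚ) • (1 : Matrix (Fin 12) (Fin 12) ℚ)) 0 l k : ℚ) : ℂ) •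
              Sum.elim (fun i => complexBetti.map (fst A A).hom.hom.hom 1 (u i))
                (fun i => complexBetti.map (snd A A).hom.hom.hom 1 (u i)) l) ∧
          (∀ k l : Fin 12 ⊕ Fin 12, polarizationPairingOne (A.prod A).X
              ((7 : ℂ) • (((t : ℂ) • complexBetti.map e.ι 2 a' +
                  complexBetti.map (prodLift ((t : ℤ) • snd A A) (fst A A)).hom.hom.hom 2
                    (complexBetti.map e.ι 2 a'))) +
                complexBetti.map (prodLift (fst A A ≫ φ) (snd A A ≫ φ)).hom.hom.hom 2
                  ((t : ℂ) • complexBetti.map e.ι 2 a' +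
                    complexBetti.map (prodLift ((t : ℤ) • snd A A) (fst A A)).hom.hom.hom 2
                      (complexBetti.map e.ι 2 a')))
              11
              (Sum.elim (fun i => complexBetti.map (fst A A).hom.hom.hom 1 (u i))
                (fun i => complexBetti.map (snd A A).hom.hom.hom 1 (u i)) k)
              (Sum.elim (fun i => complexBetti.map (fst A A).hom.hom.hom 1 (u i))
                (fun i => complexBetti.map (snd A A).hom.hom.hom 1 (u i)) l) =
            ((r * Matrix.fromBlocks ((t : ℚ) • G) 0 0 G k l : ℚ) : ℂ) • Ω) := by
  intro A φ hA hφ eA a ha ha0 u M G ω d₀ hu hui hus hM hG hd₀ t ht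
  classical
  obtain ⟨g, hg_rat, hg_ne, hg_dim, hg_segre, -, hg_span, -⟩ :=
    HyperbolicEightfoldDescent.stub_hyperplaneCalculusSym
  -- `a = q • g`, `q ≠ 0`
  obtain ⟨q, rfl⟩ := hg_span eA.n a ha
  have hq0 : q ≠ 0 := by
    rintro rfl
    exact ha0 (by rw [Rat.cast_zero, zero_smul])
  -- the Segre embedding `e` of `A × A` and the class `a' = q • g`
  obtain ⟨e, he⟩ := hg_segre A A eA eA
  have hdim : 1 ≤ (A.prod A).dim := by
    rw [AbelianVariety.dim_prod, hA]
    omega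
  have hen : 1 ≤ e.n := hg_dim (A.prod A) e hdim
  have ha' : IsRationalClass ((((q : ℚ) : ℂ)) • g e.n) := (hg_rat e.n).smul q
  have ha'0 : (((q : ℚ) : ℂ)) • g e.n ≠ 0 :=
    smul_ne_zero (Rat.cast_ne_zero.2 hq0) (hg_ne e.n hen)
  -- `e^* a' = fst^* x + snd^* x`, `x = e_A^* a`
  have hea' : complexBetti.map e.ι 2 ((((q : ℚ) : ℂ)) • g e.n) =
      complexBetti.map (fst A A).hom.hom.hom 2 (complexBetti.map eA.ι 2 ((((q : ℚ) : ℂ)) • g eA.n)) +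
        complexBetti.map (snd A A).hom.hom.hom 2 (complexBetti.map eA.ι 2 ((((q : ℚ) : ℂ)) • g eA.n)) := by
    simp only [map_smul, he, smul_add]
  -- abbreviations
  set x : complexBetti A.X 2 := complexBetti.map eA.ι 2 ((((q : ℚ) : ℂ)) • g eA.n) with hx
  set hAc : complexBetti A.X 2 := (7 : ℂ) • x + complexBetti.map φ.hom.hom.hom 2 x with hhAc
  -- the models of the rescaled classes `(1+t) • h_A` and `((1+t) t) • h_A`
  have hGA : ∀ i j, polarizationPairingOne A.X (((t : ℂ) + 1) • hAc) 5 (u i) (u j) =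
      ((((((t : ℚ) + 1) ^ 5) • G) i j : ℚ) : ℂ) • ω := by
    intro i j
    rw [polarizationPairingOne_smul, hG, smul_smul, Matrix.smul_apply, smul_eq_mul]
    congr 1
    push_cast
    ring
  have hdA : lefschetzPow (((t : ℂ) + 1) • hAc) 5 2 (((t : ℂ) + 1) • hAc) =
      (((((t : ℚ) + 1) ^ 6 * d₀ : ℚ)) : ℂ) • ω := by
    rw [lefschetzPow_smul, map_smul, hd₀, smul_smul, smul_smul]
    congr 1
    push_cast
    ring
  have hGB : ∀ i j, polarizationPairingOne A.X ((((t : ℂ) + 1) * (t : ℂ)) • hAc) 5 (u i) (u j) =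
      (((((((t : ℚ) + 1) * t) ^ 5) • G) i j : ℚ) : ℂ) • ω := by
    intro i j
    rw [polarizationPairingOne_smul, hG, smul_smul, Matrix.smul_apply, smul_eq_mul]
    congr 1
    push_cast
    ring
  have hdB : lefschetzPow ((((t : ℂ) + 1) * (t : ℂ)) • hAc) 5 2 ((((t : ℂ) + 1) * (t : ℂ)) • hAc) =
      ((((((t : ℚ) + 1) * t) ^ 6 * d₀ : ℚ)) : ℂ) • ω := by
    rw [lefschetzPow_smul, map_smul, hd₀, smul_smul, smul_smul]
    congr 1
    push_cast
    ring
  -- the block Gram matrix of `fst^*((1+t) h_A) + snd^*(((1+t)t) h_A)` (van Geemen 5.2 (3))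
  have hA6 : A.dim = 5 + 1 := hA
  have key := polarizationPairingOne_sumElim hA6 hA6 (m := 11) rfl u u
    (((t : ℂ) + 1) • hAc) ω _ hGA _ hdA ((((t : ℂ) + 1) * (t : ℂ)) • hAc) ω _ hGB _ hdB
  have h462 : (11 : ℕ).choose 5 = 462 := by decide
  have h462' : (11 : ℕ).choose (5 + 1) = 462 := by decide
  refine ⟨e, (((q : ℚ) : ℂ)) • g e.n, 462 * d₀ * (t : ℚ) ^ 5 * ((t : ℚ) + 1) ^ 11,
    cupProduct (by norm_num : (2 + 2 * 5) + (2 + 2 * 5) = 2 + 2 * 11)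
      (complexBetti.map (fst A A).hom.hom.hom (2 + 2 * 5) ω)
      (complexBetti.map (snd A A).hom.hom.hom (2 + 2 * 5) ω),
    ha', ha'0, fun k => map_prodLift_sumElim φ φ u M hM u M hM k, ?_, ?_⟩
  · -- the matrix of `ψ_F^*`
    rintro (i | i)
    · simp only [Sum.elim_inl, Sum.elim_inr, Fintype.sum_sum_type, Matrix.fromBlocks_apply₁₁,
        Matrix.fromBlocks_apply₂₁, Matrix.zero_apply, Rat.cast_zero, zero_smul,
        Finset.sum_const_zero, zero_add]
      rw [map_psiF_map_fst, pow_one, sum_ratCast_smul_one_apply_smul, Rat.cast_natCast]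
    · simp only [Sum.elim_inr, Sum.elim_inl, Fintype.sum_sum_type, Matrix.fromBlocks_apply₁₂,
        Matrix.fromBlocks_apply₂₂, Matrix.zero_apply, Rat.cast_zero, zero_smul,
        Finset.sum_const_zero, add_zero]
      rw [map_psiF_map_snd, sum_ratCast_one_apply_smul]
  · -- the Gram matrix of the `L`-symmetrised hyperplane class
    intro k l
    rw [hea', map_lSymm_segreClass A φ t x, key k l]
    congr 2
    rcases k with i | i <;> rcases l with j | j <;>
      simp only [Matrix.fromBlocks_apply₁₁, Matrix.fromBlocks_apply₁₂, Matrix.fromBlocks_apply₂₁,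
        Matrix.fromBlocks_apply₂₂, Matrix.smul_apply, Matrix.zero_apply, smul_eq_mul, mul_zero,
        h462, h462', Nat.cast_ofNat] <;> ring

end Summit.HodgeConjecture.HodgeConjecture.Theorems.WeilSixfoldsSqrtMinus7.RealQuadraticBaseChange

end
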